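import Literature.Analysis.Complex.StripFourierDecay
import Literature.Analysis.FunctionSpaces.GaussianSchwartz
import Mathlib.Analysis.Distribution.SchwartzSpace.Fourier
import HarnessLib

/-!
# The flat tube theorem by Fourier transform, I: decay of the Gaussian-windowed Fourier data

Analysis/Complex support file (everything proved; no definitions, no named facts). First part of
an elementary proof of the **Malgrange–Zerner "flat tube" theorem** in tempered form (H. Epstein,
*Some analytic properties of scattering amplitudes in quantum field theory*, Brandeis lectures 1965,
Ch. 1; used by Osterwalder–Schrader, Comm. Math. Phys. 42 (1975), p. 292, to continue the Schwinger
functions jointly in all time variables): a function of `k` real variables which, in each variable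
separately, is the restriction of a function holomorphic in the strip `{|Im| < a}` extends to a
function holomorphic in the tube over the *convex hull* `{∑ⱼ |Im zⱼ| < a}` of the `k` flat tubes.

The setting (this file and its sequels `FlatTubeFourierSynthesis`, `FlatTubeFourier`). The datum is
a functional `T` on `k`-tuples of functions `ℝ → ℂ`, thought of as a distribution in `k` real
variables `s = (s₁, …, s_k)` with the Gaussian window `w(s) = e^{-bs²}` built into each slot, about
which we only ever use **slot representations**: for a slot `i` and a tuple `θ` of Schwartz
functions, `T(θ[i ↦ ϑ]) = ∫ g(s) e^{-bs²} ϑ(s) ds` for all Schwartz `ϑ`, with `g` holomorphic in the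
strip `{|Im z| < a}` and `‖g(x+iy)‖ ≤ M e^{κ|x|}` on closed sub-strips (in the application to OS II,
`sⱼ = log` of the `j`-th time difference and `g(s) = ⟨v, e^{-e^{s}H} v'⟩ e^{s}` comes from the
holomorphic contraction semigroup; the bound `M` grows polynomially in the frequencies of the other
slots). The **Gaussian-windowed Fourier data** of `T` is the function
`Φ(p) = T(ψ_{p₁}, …, ψ_{p_k})`, `ψ_q(s) = e^{-bs²} e^{-2πiqs}`. This file proves:

* `exists_schwartzMap_gaussMod` — `ψ_q` is a Schwartz function;
* `apply_gaussMod_eq_fourier` — through the slot-`i` representation,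
  `Φ(p) = 𝓕(g · e^{-2b·²})(pᵢ)`;
* `norm_apply_gaussMod_le_of_slot` — hence (`StripFourierDecay`)
  `‖Φ(p)‖ ≤ M e^{2bc²} (∫ e^{κ|x|-2bx²}) e^{-2πc|pᵢ|}` for every `c ∈ [0, a)`;
* `norm_apply_gaussMod_le` — **the decay in the sup norm**: if every slot has such a
  representation with `M ≤ C (1 + ‖p‖)ᴺ`, then `‖Φ(p)‖ ≤ C K (1 + ‖p‖)ᴺ e^{-2πc‖p‖}`,
  `‖p‖ = maxᵢ |pᵢ|` — the minimum over the slots of `e^{-2πc|pᵢ|}` is `e^{-2πc‖p‖_∞}`, and the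
  `ℓ¹–ℓ^∞` duality is exactly why the Fourier–Laplace integral `∫ Φ(p) e^{2πi p·z} dp` will converge
  on the `ℓ¹`-tube `{∑|Im zⱼ| < a}`, the convex hull of the flat tubes (`FlatTubeFourier`).

## References

* H. Epstein, in: *Axiomatic Field Theory* (Brandeis 1965), Gordon and Breach 1966 (the
  Malgrange–Zerner theorem).
* K. Osterwalder, R. Schrader, *Axioms for Euclidean Green's functions II*, Comm. Math. Phys. 42
  (1975) 281–305, §V.1 p. 292. [OsterwalderSchraderCMP1975]

Everything here is elementary and tagged folklore.
-/

noncomputable section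

open _root_.Complex Set MeasureTheory Filter Real SchwartzMap Literature.Analysis.FunctionSpaces
open scoped _root_.Topology FourierTransform

namespace Literature.Analysis.Complex

variable {k : ℕ} {a b c κ M : ℝ}

/-! ### The modulated Gaussians `ψ_q(s) = e^{-bs²} e^{-2πiqs}` -/

/-- The character `s ↦ e^{-2πisq}` has temperate growth (all derivatives have modulus
`(2π|q|)ⁿ`). [folklore] -/
theorem hasTemperateGrowth_cexp_neg_two_pi_mul_I (q : ℝ) :
    Function.HasTemperateGrowth fun s : ℝ => Complex.exp (↑(-2 * π * s * q) * I) := by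
  set C : ℂ := ↑(-2 * π * q) * I with hC
  set E : ℝ → ℂ := fun s => Complex.exp (C * s) with hE
  have hfun : (fun s : ℝ => Complex.exp (↑(-2 * π * s * q) * I)) = E := by
    funext s; rw [hE, hC]; congr 1; push_cast; ring
  rw [hfun]
  have hd : ∀ s : ℝ, HasDerivAt E (C * E s) s := fun s => by
    have h := ((hasDerivAt_id (s : ℂ)).const_mul C).cexp.comp_ofReal
    simpa [hE, mul_comm] using h
  have hderiv : deriv E = fun s => C * E s := funext fun s => (hd s).deriv
  have hiter : ∀ n : ℕ, iteratedDeriv n E = fun s => C ^ n * E s := by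
    intro n
    induction n with
    | zero => funext s; simp [iteratedDeriv_zero]
    | succ n ih =>
        rw [iteratedDeriv_succ, ih]
        funext s
        rw [deriv_const_mul _ (hd s).differentiableAt, hderiv]
        ring
  have hcd : ContDiff ℝ (⊤ : ℕ∞) E :=
    Complex.contDiff_exp.comp (contDiff_const.mul Complex.ofRealCLM.contDiff)
  refine ⟨hcd, fun n => ⟨0, ‖C‖ ^ n, fun s => ?_⟩⟩
  rw [norm_iteratedFDeriv_eq_norm_iteratedDeriv, hiter]
  simp only [norm_mul, norm_pow, pow_zero, mul_one]
  have : ‖E s‖ = 1 := by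
    rw [hE, hC, Complex.norm_exp]
    simp
  rw [this, mul_one]

/-- **`ψ_q(s) = e^{-bs²} e^{-2πisq}` is a Schwartz function** (`b > 0`): the Gaussian Schwartz
function multiplied by a function of temperate growth. [folklore] -/
theorem exists_schwartzMap_gaussMod (hb : 0 < b) (q : ℝ) :
    ∃ φ : 𝓢(ℝ, ℂ), ∀ s : ℝ,
      φ s = Complex.exp (-(b : ℂ) * (s : ℂ) ^ 2) * Complex.exp (↑(-2 * π * s * q) * I) := by
  refine ⟨SchwartzMap.smulLeftCLM ℂ (fun s : ℝ => Complex.exp (↑(-2 * π * s * q) * I))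
    (gaussianSchwartz ℝ b), fun s => ?_⟩
  rw [SchwartzMap.smulLeftCLM_apply_apply (hasTemperateGrowth_cexp_neg_two_pi_mul_I q),
    gaussianSchwartz_apply hb, smul_eq_mul, mul_comm, Complex.ofReal_exp]
  congr 2
  rw [Real.norm_eq_abs, sq_abs]
  push_cast
  ring

/-- Pointwise form of the window times a modulated Gaussian:
`e^{-bs²} ψ_q(s) = e^{-2πisq} e^{-2bs²}`. [folklore] -/
theorem gaussian_mul_gaussMod (b q s : ℝ) :
    Complex.exp (-(b : ℂ) * (s : ℂ) ^ 2) *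
        (Complex.exp (-(b : ℂ) * (s : ℂ) ^ 2) * Complex.exp (↑(-2 * π * s * q) * I)) =
      Complex.exp (↑(-2 * π * s * q) * I) * Complex.exp (-((2 * b : ℝ) : ℂ) * (s : ℂ) ^ 2) := by
  rw [← mul_assoc, ← Complex.exp_add, mul_comm]
  congr 2
  push_cast
  ring

/-! ### The windowed Fourier data through a slot representation -/

/-- **Slot formula for the Gaussian-windowed Fourier data.** If slot `i` of `T` at the tuple
`(ψ_{p_j})_j` is represented by `g` — `T(ψ_p[i ↦ ϑ]) = ∫ g(s) e^{-bs²} ϑ(s) ds` for all Schwartz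
`ϑ` — then `Φ(p) = T(ψ_{p_1}, …, ψ_{p_k}) = 𝓕(g · e^{-2b·²})(pᵢ)`. [folklore] -/
theorem apply_gaussMod_eq_fourier (hb : 0 < b) {T : (Fin k → ℝ → ℂ) → ℂ} {p : Fin k → ℝ}
    {i : Fin k} {g : ℂ → ℂ}
    (hrep : ∀ ϑ : 𝓢(ℝ, ℂ), T (Function.update
        (fun j (s : ℝ) => Complex.exp (-(b : ℂ) * (s : ℂ) ^ 2) * Complex.exp (↑(-2 * π * s * p j) * I))
        i ϑ) = ∫ s : ℝ, g s * Complex.exp (-(b : ℂ) * (s : ℂ) ^ 2) * ϑ s) :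
    T (fun j (s : ℝ) => Complex.exp (-(b : ℂ) * (s : ℂ) ^ 2) * Complex.exp (↑(-2 * π * s * p j) * I)) =
      𝓕 (fun s : ℝ => g s * Complex.exp (-((2 * b : ℝ) : ℂ) * (s : ℂ) ^ 2)) (p i) := by
  obtain ⟨φ, hφ⟩ := exists_schwartzMap_gaussMod hb (p i)
  have hupd : Function.update
      (fun j (s : ℝ) => Complex.exp (-(b : ℂ) * (s : ℂ) ^ 2) * Complex.exp (↑(-2 * π * s * p j) * I))
      i (φ : ℝ → ℂ) =
      fun j (s : ℝ) => Complex.exp (-(b : ℂ) * (s : ℂ) ^ 2) * Complex.exp (↑(-2 * π * s * p j) * I) := by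
    have : (φ : ℝ → ℂ) = fun s : ℝ =>
        Complex.exp (-(b : ℂ) * (s : ℂ) ^ 2) * Complex.exp (↑(-2 * π * s * p i) * I) := funext hφ
    rw [this]
    exact Function.update_eq_self i _
  rw [← hupd, hrep φ, Real.fourier_real_eq_integral_exp_smul]
  refine integral_congr_ae (Eventually.of_forall fun s => ?_)
  simp only [hφ, smul_eq_mul]
  rw [mul_assoc, gaussian_mul_gaussMod]
  ring

/-- **Decay of the windowed Fourier data in one frequency.** If slot `i` of `T` at `(ψ_{p_j})_j`
is represented by `g` holomorphic in `{|Im z| < a}` with `‖g(x+iy)‖ ≤ M e^{κ|x|}` for `|y| ≤ c`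
(`0 ≤ c < a`), then `‖Φ(p)‖ ≤ M e^{2bc²} (∫ e^{κ|x| - 2bx²} dx) e^{-2πc|pᵢ|}`
(`norm_fourier_mul_gaussian_le_of_strip`). [folklore] -/
theorem norm_apply_gaussMod_le_of_slot (hb : 0 < b) (hc : 0 ≤ c) (hca : c < a)
    {T : (Fin k → ℝ → ℂ) → ℂ} {p : Fin k → ℝ} {i : Fin k} {g : ℂ → ℂ}
    (hg : DifferentiableOn ℂ g {z : ℂ | |z.im| < a})
    (hM : ∀ z : ℂ, |z.im| ≤ c → ‖g z‖ ≤ M * Real.exp (κ * |z.re|))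
    (hrep : ∀ ϑ : 𝓢(ℝ, ℂ), T (Function.update
        (fun j (s : ℝ) => Complex.exp (-(b : ℂ) * (s : ℂ) ^ 2) * Complex.exp (↑(-2 * π * s * p j) * I))
        i ϑ) = ∫ s : ℝ, g s * Complex.exp (-(b : ℂ) * (s : ℂ) ^ 2) * ϑ s) :
    ‖T (fun j (s : ℝ) => Complex.exp (-(b : ℂ) * (s : ℂ) ^ 2) * Complex.exp (↑(-2 * π * s * p j) * I))‖ ≤
      M * Real.exp (2 * b * c ^ 2) * (∫ x : ℝ, Real.exp (κ * |x| - 2 * b * x ^ 2)) *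
        Real.exp (-(2 * π * c * |p i|)) := by
  rw [apply_gaussMod_eq_fourier hb hrep]
  have h := norm_fourier_mul_gaussian_le_of_strip hg hc hca (by positivity : 0 < 2 * b) hM (p i)
  simpa using h

/-! ### Decay in the sup norm of the frequencies -/

/-- For a nonempty index type, some coordinate realises the sup norm: `‖p‖ = |p i|`. [folklore] -/
theorem exists_norm_eq_abs_apply [Nonempty (Fin k)] (p : Fin k → ℝ) : ∃ i : Fin k, ‖p‖ = |p i| := by
  obtain ⟨i, -, hi⟩ := Finset.exists_max_image Finset.univ (fun j => |p j|) Finset.univ_nonempty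
  refine ⟨i, le_antisymm ?_ ?_⟩
  · exact (pi_norm_le_iff_of_nonneg (abs_nonneg _)).2 fun j => by
      simpa [Real.norm_eq_abs] using hi j (Finset.mem_univ j)
  · simpa [Real.norm_eq_abs] using norm_le_pi_norm p i

/-- **Decay of the Gaussian-windowed Fourier data** (the heart of the Fourier proof of the flat tube
theorem). Suppose that at the tuple `(ψ_{p_j})_j` *every* slot `i` of `T` is represented by a
function `gᵢ` holomorphic in `{|Im z| < a}` with `‖gᵢ(x+iy)‖ ≤ C (1 + ‖p‖)ᴺ e^{κ|x|}` for `|y| ≤ c`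
(`0 ≤ c < a`). Then

  `‖Φ(p)‖ ≤ C e^{2bc²} (∫ e^{κ|x| - 2bx²} dx) (1 + ‖p‖)ᴺ e^{-2πc‖p‖}`,

`‖p‖ = maxᵢ |pᵢ|`: each slot gives the factor `e^{-2πc|pᵢ|}`, and the best slot gives
`e^{-2πc maxᵢ|pᵢ|}`. (For `k = 0` there is no slot and nothing is claimed: the hypothesis
`Nonempty (Fin k)`.) [folklore] -/
theorem norm_apply_gaussMod_le [Nonempty (Fin k)] (hb : 0 < b) (hc : 0 ≤ c) (hca : c < a)
    {T : (Fin k → ℝ → ℂ) → ℂ} {C : ℝ} {N : ℕ} {p : Fin k → ℝ}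
    (hslot : ∀ i : Fin k, ∃ g : ℂ → ℂ, DifferentiableOn ℂ g {z : ℂ | |z.im| < a} ∧
      (∀ z : ℂ, |z.im| ≤ c → ‖g z‖ ≤ C * (1 + ‖p‖) ^ N * Real.exp (κ * |z.re|)) ∧
      ∀ ϑ : 𝓢(ℝ, ℂ), T (Function.update
        (fun j (s : ℝ) => Complex.exp (-(b : ℂ) * (s : ℂ) ^ 2) * Complex.exp (↑(-2 * π * s * p j) * I))
        i ϑ) = ∫ s : ℝ, g s * Complex.exp (-(b : ℂ) * (s : ℂ) ^ 2) * ϑ s) :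
    ‖T (fun j (s : ℝ) => Complex.exp (-(b : ℂ) * (s : ℂ) ^ 2) * Complex.exp (↑(-2 * π * s * p j) * I))‖ ≤
      C * Real.exp (2 * b * c ^ 2) * (∫ x : ℝ, Real.exp (κ * |x| - 2 * b * x ^ 2)) *
        (1 + ‖p‖) ^ N * Real.exp (-(2 * π * c * ‖p‖)) := by
  obtain ⟨i, hi⟩ := exists_norm_eq_abs_apply p
  obtain ⟨g, hg, hM, hrep⟩ := hslot i
  have h := norm_apply_gaussMod_le_of_slot hb hc hca hg hM hrep
  rw [← hi] at h
  convert h using 1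
  ring

/-! ### Continuity of the windowed Fourier data

The data `Φ(p) = T(ψ_{p_1}, …, ψ_{p_k})` is continuous as soon as every slot is represented, at
every tuple of modulated Gaussians, by a function bounded by `C (1 + ‖p‖)ᴺ e^{κ|x|}` on the real
line: changing one frequency `pᵢ ↦ t` changes `Φ` by `∫ gᵢ(s) e^{-2bs²} (e^{-2πist} − e^{-2πispᵢ}) ds`,
of size `≤ 2π |t − pᵢ| C(1 + ‖p‖)ᴺ ∫ |s| e^{κ|s|-2bs²}`, and a general change of `p` is a chain of `k`
such one-frequency changes. -/

/-- **Coordinatewise Lipschitz functions on `ℝᵏ` are continuous**: if on every ball `‖p‖ ≤ R`,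
changing one coordinate to a value `t` with `|t| ≤ R` changes `Φ` by at most `L_R |t − pᵢ|`, then `Φ`
is continuous (telescoping over the coordinates). [folklore] -/
theorem continuous_of_update_lipschitz {E : Type*} [SeminormedAddCommGroup E] {Φ : (Fin k → ℝ) → E}
    (h : ∀ R : ℝ, ∃ L : ℝ, ∀ p : Fin k → ℝ, ‖p‖ ≤ R → ∀ (i : Fin k) (t : ℝ), |t| ≤ R →
      ‖Φ (Function.update p i t) - Φ p‖ ≤ L * |t - p i|) :
    Continuous Φ := by
  refine continuous_iff_continuousAt.2 fun p₀ => ?_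
  obtain ⟨L₀, hL₀⟩ := h (‖p₀‖ + 1)
  -- we may take the Lipschitz constant nonnegative
  set L : ℝ := max L₀ 0 with hLdef
  have hL0 : 0 ≤ L := le_max_right _ _
  have hL : ∀ p : Fin k → ℝ, ‖p‖ ≤ ‖p₀‖ + 1 → ∀ (i : Fin k) (t : ℝ), |t| ≤ ‖p₀‖ + 1 →
      ‖Φ (Function.update p i t) - Φ p‖ ≤ L * |t - p i| := fun p hp i t ht =>
    (hL₀ p hp i t ht).trans (mul_le_mul_of_nonneg_right (le_max_left _ _) (abs_nonneg _))
  rw [ContinuousAt, tendsto_iff_norm_sub_tendsto_zero]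
  -- the chain `m n`: first `n` coordinates from `p`, the rest from `p₀`
  have key : ∀ p : Fin k → ℝ, ‖p - p₀‖ ≤ 1 → ‖Φ p - Φ p₀‖ ≤ (k * L) * ‖p - p₀‖ := by
    intro p hp
    set m : ℕ → (Fin k → ℝ) := fun n j => if (j : ℕ) < n then p j else p₀ j with hm
    have hm0 : m 0 = p₀ := by funext j; simp [hm]
    have hmk : m k = p := by funext j; simp [hm, j.isLt]
    have hpR : ‖p‖ ≤ ‖p₀‖ + 1 := by
      calc ‖p‖ = ‖p₀ + (p - p₀)‖ := by rw [add_sub_cancel]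
        _ ≤ ‖p₀‖ + ‖p - p₀‖ := norm_add_le _ _
        _ ≤ ‖p₀‖ + 1 := by linarith
    have hmR : ∀ n, ‖m n‖ ≤ ‖p₀‖ + 1 := by
      intro n
      refine (pi_norm_le_iff_of_nonneg (by positivity)).2 fun j => ?_
      simp only [hm]
      split_ifs
      · exact (norm_le_pi_norm p j).trans hpR
      · exact (norm_le_pi_norm p₀ j).trans (by linarith)
    have hstep : ∀ n, n < k → ‖Φ (m (n + 1)) - Φ (m n)‖ ≤ L * ‖p - p₀‖ := by
      intro n hn
      set i : Fin k := ⟨n, hn⟩ with hi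
      have hupd : m (n + 1) = Function.update (m n) i (p i) := by
        funext j
        by_cases hj : j = i
        · subst hj
          simp [hm, hi]
        · rw [Function.update_of_ne hj]
          have hjn : (j : ℕ) ≠ n := fun h' => hj (Fin.ext h')
          simp only [hm]
          have : ((j : ℕ) < n + 1) ↔ ((j : ℕ) < n) := by omega
          simp [this]
      have hmi : m n i = p₀ i := by simp [hm, hi]
      have hpi : |p i| ≤ ‖p₀‖ + 1 := by
        simpa [Real.norm_eq_abs] using (norm_le_pi_norm p i).trans hpR
      calc ‖Φ (m (n + 1)) - Φ (m n)‖ = ‖Φ (Function.update (m n) i (p i)) - Φ (m n)‖ := by rw [hupd]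
        _ ≤ L * |p i - m n i| := hL (m n) (hmR n) i (p i) hpi
        _ = L * |p i - p₀ i| := by rw [hmi]
        _ ≤ L * ‖p - p₀‖ := by
            gcongr
            simpa [Real.norm_eq_abs] using norm_le_pi_norm (p - p₀) i
    calc ‖Φ p - Φ p₀‖ = ‖∑ n ∈ Finset.range k, (Φ (m (n + 1)) - Φ (m n))‖ := by
          rw [Finset.sum_range_sub (fun n => Φ (m n)), hm0, hmk]
      _ ≤ ∑ n ∈ Finset.range k, ‖Φ (m (n + 1)) - Φ (m n)‖ := norm_sum_le _ _
      _ ≤ ∑ n ∈ Finset.range k, L * ‖p - p₀‖ :=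
          Finset.sum_le_sum fun n hn => hstep n (Finset.mem_range.1 hn)
      _ = (k * L) * ‖p - p₀‖ := by rw [Finset.sum_const, Finset.card_range]; simp; ring
  -- squeeze
  have hlim : Tendsto (fun p : Fin k → ℝ => (k * L) * ‖p - p₀‖) (𝓝 p₀) (𝓝 0) := by
    have h1 : Tendsto (fun p : Fin k → ℝ => p - p₀) (𝓝 p₀) (𝓝 0) := by
      simpa using (tendsto_id (x := 𝓝 p₀)).sub (tendsto_const_nhds (x := p₀))
    simpa using (tendsto_norm_zero.comp h1).const_mul (k * L)
  refine squeeze_zero_norm' ?_ hlim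
  filter_upwards [Metric.closedBall_mem_nhds p₀ one_pos] with p hp
  rw [norm_norm]
  exact key p (by simpa [dist_eq_norm] using hp)

/-- A slot representation with a real-line bound forces the bound constant to be nonnegative.
[folklore] -/
theorem nonneg_of_norm_le_mul_exp {g : ℂ → ℂ} (hM : ∀ x : ℝ, ‖g x‖ ≤ M * Real.exp (κ * |x|)) :
    0 ≤ M := by
  have h := hM 0
  simp only [ofReal_zero, abs_zero, mul_zero, Real.exp_zero, mul_one] at h
  exact (norm_nonneg _).trans h

/-- Integrability of `s ↦ g(s) e^{-bs²} ϑ(s)` on the real line for `g` continuous on the strip with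
`‖g(x)‖ ≤ M e^{κ|x|}` and `ϑ` bounded continuous (e.g. Schwartz). [folklore] -/
theorem integrable_mul_gaussian_mul (hb : 0 < b) (ha : 0 < a) {g : ℂ → ℂ}
    (hg : ContinuousOn g {z : ℂ | |z.im| < a}) (hM : ∀ x : ℝ, ‖g x‖ ≤ M * Real.exp (κ * |x|))
    {ϑ : ℝ → ℂ} (hϑ : Continuous ϑ) {K : ℝ} (hK : ∀ s, ‖ϑ s‖ ≤ K) :
    Integrable fun s : ℝ => g s * Complex.exp (-(b : ℂ) * (s : ℂ) ^ 2) * ϑ s := by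
  have hgc : Continuous fun s : ℝ => g s :=
    hg.comp_continuous Complex.continuous_ofReal fun s => by simpa using ha
  refine ((integrable_exp_mul_abs_sub_mul_sq hb κ).const_mul (M * K)).mono'
    ((hgc.mul (by fun_prop)).mul hϑ).aestronglyMeasurable (Eventually.of_forall fun s => ?_)
  rw [norm_mul, norm_mul, Complex.norm_exp]
  have hre : (-(b : ℂ) * (s : ℂ) ^ 2).re = -b * s ^ 2 := by
    simp only [sq, neg_mul, neg_re, mul_re, mul_im, ofReal_re, ofReal_im, mul_zero, sub_zero,
      zero_mul, add_zero]
  rw [hre]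
  have hM0 : 0 ≤ M := nonneg_of_norm_le_mul_exp hM
  calc ‖g s‖ * Real.exp (-b * s ^ 2) * ‖ϑ s‖
      ≤ M * Real.exp (κ * |s|) * Real.exp (-b * s ^ 2) * K :=
        mul_le_mul (mul_le_mul_of_nonneg_right (hM s) (Real.exp_pos _).le) (hK s) (norm_nonneg _)
          (by positivity)
    _ = M * K * Real.exp (κ * |s| - b * s ^ 2) := by
        rw [sub_eq_add_neg, Real.exp_add]; ring

/-- **One-frequency variation of the windowed Fourier data.** If slot `i` of `T` at `(ψ_{p_j})_j`
is represented by `g` with `‖g(x)‖ ≤ M e^{κ|x|}` on the real line, then replacing the frequency `pᵢ`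
by `t` changes `Φ` by at most `2π M (∫ e^{(κ+1)|x| - 2bx²} dx) |t − pᵢ|` (since
`|e^{-2πist} − e^{-2πispᵢ}| ≤ 2π|s||t − pᵢ|` and `|s| ≤ e^{|s|}`). [folklore] -/
theorem norm_apply_gaussMod_update_sub_le (hb : 0 < b) (ha : 0 < a) {T : (Fin k → ℝ → ℂ) → ℂ}
    {p : Fin k → ℝ} {i : Fin k} {g : ℂ → ℂ}
    (hg : ContinuousOn g {z : ℂ | |z.im| < a}) (hM : ∀ x : ℝ, ‖g x‖ ≤ M * Real.exp (κ * |x|))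
    (hrep : ∀ ϑ : 𝓢(ℝ, ℂ), T (Function.update
        (fun j (s : ℝ) => Complex.exp (-(b : ℂ) * (s : ℂ) ^ 2) * Complex.exp (↑(-2 * π * s * p j) * I))
        i ϑ) = ∫ s : ℝ, g s * Complex.exp (-(b : ℂ) * (s : ℂ) ^ 2) * ϑ s) (t : ℝ) :
    ‖T (fun j (s : ℝ) => Complex.exp (-(b : ℂ) * (s : ℂ) ^ 2) *
          Complex.exp (↑(-2 * π * s * Function.update p i t j) * I)) -
        T (fun j (s : ℝ) => Complex.exp (-(b : ℂ) * (s : ℂ) ^ 2) *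
          Complex.exp (↑(-2 * π * s * p j) * I))‖ ≤
      2 * π * M * (∫ x : ℝ, Real.exp ((κ + 1) * |x| - 2 * b * x ^ 2)) * |t - p i| := by
  obtain ⟨φt, hφt⟩ := exists_schwartzMap_gaussMod hb t
  obtain ⟨φu, hφu⟩ := exists_schwartzMap_gaussMod hb (p i)
  -- the two tuples as updates of slot `i`
  have ht : (fun j (s : ℝ) => Complex.exp (-(b : ℂ) * (s : ℂ) ^ 2) *
        Complex.exp (↑(-2 * π * s * Function.update p i t j) * I)) =
      Function.update (fun j (s : ℝ) => Complex.exp (-(b : ℂ) * (s : ℂ) ^ 2) *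
        Complex.exp (↑(-2 * π * s * p j) * I)) i (φt : ℝ → ℂ) := by
    funext j
    by_cases hj : j = i
    · subst hj; funext s; simp [hφt]
    · rw [Function.update_of_ne hj]; funext s; simp [Function.update_of_ne hj]
  have hu : (fun j (s : ℝ) => Complex.exp (-(b : ℂ) * (s : ℂ) ^ 2) *
        Complex.exp (↑(-2 * π * s * p j) * I)) =
      Function.update (fun j (s : ℝ) => Complex.exp (-(b : ℂ) * (s : ℂ) ^ 2) *
        Complex.exp (↑(-2 * π * s * p j) * I)) i (φu : ℝ → ℂ) := by
    have : (φu : ℝ → ℂ) = fun s : ℝ =>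
        Complex.exp (-(b : ℂ) * (s : ℂ) ^ 2) * Complex.exp (↑(-2 * π * s * p i) * I) := funext hφu
    rw [this, Function.update_eq_self]
  have hone : ∀ (φ : 𝓢(ℝ, ℂ)) (q : ℝ), (∀ s : ℝ, φ s = Complex.exp (-(b : ℂ) * (s : ℂ) ^ 2) *
      Complex.exp (↑(-2 * π * s * q) * I)) → ∀ s : ℝ, ‖φ s‖ ≤ 1 := by
    intro φ q hφ s
    rw [hφ, norm_mul, Complex.norm_exp, Complex.norm_exp]
    have h1 : (-(b : ℂ) * (s : ℂ) ^ 2).re = -b * s ^ 2 := by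
      simp only [sq, neg_mul, neg_re, mul_re, mul_im, ofReal_re, ofReal_im, mul_zero, sub_zero,
        zero_mul, add_zero]
    have h2 : ((↑(-2 * π * s * q) : ℂ) * I).re = 0 := by simp
    rw [h1, h2, Real.exp_zero, mul_one]
    exact Real.exp_le_one_iff.2 (by nlinarith [sq_nonneg s])
  have hit := integrable_mul_gaussian_mul hb ha hg hM φt.continuous (hone φt t hφt)
  have hiu := integrable_mul_gaussian_mul hb ha hg hM φu.continuous (hone φu (p i) hφu)
  rw [ht, hrep φt, hu, hrep φu, ← integral_sub hit hiu]
  have hM0 : 0 ≤ M := nonneg_of_norm_le_mul_exp hM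
  -- pointwise bound of the difference
  have hpt : ∀ s : ℝ, ‖g s * Complex.exp (-(b : ℂ) * (s : ℂ) ^ 2) * φt s -
      g s * Complex.exp (-(b : ℂ) * (s : ℂ) ^ 2) * φu s‖ ≤
      2 * π * M * |t - p i| * Real.exp ((κ + 1) * |s| - 2 * b * s ^ 2) := by
    intro s
    rw [← mul_sub, norm_mul, norm_mul, Complex.norm_exp, hφt, hφu, ← mul_sub, norm_mul,
      Complex.norm_exp]
    have h1 : (-(b : ℂ) * (s : ℂ) ^ 2).re = -b * s ^ 2 := by
      simp only [sq, neg_mul, neg_re, mul_re, mul_im, ofReal_re, ofReal_im, mul_zero, sub_zero,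
        zero_mul, add_zero]
    rw [h1]
    -- `‖e^{-2πist} - e^{-2πisu}‖ ≤ 2π|s||t - u|`
    have hchar : ‖Complex.exp (↑(-2 * π * s * t) * I) - Complex.exp (↑(-2 * π * s * p i) * I)‖ ≤
        2 * π * |s| * |t - p i| := by
      have hfac : Complex.exp (↑(-2 * π * s * t) * I) - Complex.exp (↑(-2 * π * s * p i) * I) =
          Complex.exp (↑(-2 * π * s * p i) * I) *
            (Complex.exp (I * ↑(-2 * π * s * (t - p i))) - 1) := by
        rw [mul_sub, mul_one, ← Complex.exp_add]
        congr 2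
        push_cast
        ring
      rw [hfac, norm_mul, Complex.norm_exp]
      have h0 : ((↑(-2 * π * s * p i) : ℂ) * I).re = 0 := by simp
      rw [h0, Real.exp_zero, one_mul]
      refine norm_exp_I_mul_ofReal_sub_one_le.trans ?_
      rw [Real.norm_eq_abs, abs_mul, abs_mul, abs_mul, abs_neg, abs_two, abs_of_pos Real.pi_pos]
    have hs1 : |s| ≤ Real.exp |s| := by linarith [add_one_le_exp |s|]
    calc ‖g s‖ * Real.exp (-b * s ^ 2) * (Real.exp (-b * s ^ 2) *
          ‖Complex.exp (↑(-2 * π * s * t) * I) - Complex.exp (↑(-2 * π * s * p i) * I)‖)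
        ≤ M * Real.exp (κ * |s|) * Real.exp (-b * s ^ 2) * (Real.exp (-b * s ^ 2) *
            (2 * π * Real.exp |s| * |t - p i|)) := by
          gcongr
          · exact hM s
          · exact hchar.trans (by gcongr)
      _ = 2 * π * M * |t - p i| * Real.exp ((κ + 1) * |s| - 2 * b * s ^ 2) := by
          have : Real.exp ((κ + 1) * |s| - 2 * b * s ^ 2) =
              Real.exp (κ * |s|) * Real.exp (-b * s ^ 2) * Real.exp (-b * s ^ 2) * Real.exp |s| := by
            rw [← Real.exp_add, ← Real.exp_add, ← Real.exp_add]; congr 1; ring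
          rw [this]; ring
  refine (norm_integral_le_of_norm_le ((integrable_exp_mul_abs_sub_mul_sq (by positivity : 0 < 2 * b)
    (κ + 1)).const_mul (2 * π * M * |t - p i|)) (Eventually.of_forall hpt)).trans ?_
  rw [integral_const_mul]
  exact le_of_eq (by ring)

/-- **Continuity of the Gaussian-windowed Fourier data.** If at every tuple of modulated
Gaussians every slot of `T` is represented by a function continuous on the strip and bounded on
the real line by `C (1 + ‖p‖)ᴺ e^{κ|x|}`, then `Φ(p) = T(ψ_{p_1}, …, ψ_{p_k})` is continuous
(coordinatewise Lipschitz, `norm_apply_gaussMod_update_sub_le`, and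
`continuous_of_update_lipschitz`). [folklore] -/
theorem continuous_apply_gaussMod (hb : 0 < b) (ha : 0 < a) {T : (Fin k → ℝ → ℂ) → ℂ}
    {C : ℝ} {N : ℕ}
    (hslot : ∀ (p : Fin k → ℝ) (i : Fin k), ∃ g : ℂ → ℂ, ContinuousOn g {z : ℂ | |z.im| < a} ∧
      (∀ x : ℝ, ‖g x‖ ≤ C * (1 + ‖p‖) ^ N * Real.exp (κ * |x|)) ∧
      ∀ ϑ : 𝓢(ℝ, ℂ), T (Function.update
        (fun j (s : ℝ) => Complex.exp (-(b : ℂ) * (s : ℂ) ^ 2) * Complex.exp (↑(-2 * π * s * p j) * I))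
        i ϑ) = ∫ s : ℝ, g s * Complex.exp (-(b : ℂ) * (s : ℂ) ^ 2) * ϑ s) :
    Continuous fun p : Fin k → ℝ => T (fun j (s : ℝ) =>
      Complex.exp (-(b : ℂ) * (s : ℂ) ^ 2) * Complex.exp (↑(-2 * π * s * p j) * I)) := by
  refine continuous_of_update_lipschitz fun R => ?_
  set K : ℝ := ∫ x : ℝ, Real.exp ((κ + 1) * |x| - 2 * b * x ^ 2) with hK
  refine ⟨2 * π * (|C| * (1 + |R|) ^ N) * K, fun p hp i t _ => ?_⟩
  obtain ⟨g, hg, hM, hrep⟩ := hslot p i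
  refine (norm_apply_gaussMod_update_sub_le hb ha hg hM hrep t).trans ?_
  have hK0 : 0 ≤ K := (integral_exp_mul_abs_sub_mul_sq_pos (by positivity : 0 < 2 * b) (κ + 1)).le
  have h1 : C * (1 + ‖p‖) ^ N ≤ |C| * (1 + |R|) ^ N := by
    calc C * (1 + ‖p‖) ^ N ≤ |C| * (1 + ‖p‖) ^ N := by gcongr; exact le_abs_self C
      _ ≤ |C| * (1 + |R|) ^ N := by gcongr; exact hp.trans (le_abs_self R)
  gcongr

end Literature.Analysis.Complex
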